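import Mathlib.Analysis.SpecialFunctions.Trigonometric.Arctan
import Mathlib.Topology.Algebra.Order.Floor
import Literature.Topology.PlaneTopology.CircleHomeomorphExtension
import HarnessLib

/-!
# Equivariant extensions and the collapse map of the degree lemma

Helper layer `helper_degree_collapse` of the brick `helper_sliceGluing_vanishingDegree` (apex
leaf F0, the degree lemma) of line `Sketch`, crux `SblfDescent.RungOne`
(crux item stmt-SmoothPoincare4-18531).

Degrees of loops in the circle `ℝ / ℤ ≅ 𝕊¹` are read off real lifts; a continuous self-map of the
circle of degree one is a continuous `r : ℝ → ℝ` with `r (w + 1) = r w + 1`, and post-composing a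
loop with it does not change the increment of its lifts.  This file provides:

* `helper_degree_equivariant_extension` — a continuous `κ : [-1/2, 1/2] → ℝ` with
  `κ (∓1/2) = ∓1/2` extends to a continuous `r` with `r (w + 1) = r w + 1`;
* `helper_degree_collapse` — **the collapse map** of the degree lemma: for `m₀ > 0` a continuous
  equivariant `r` with `r w = k + tan (2π (w - k)) / (2 m₀)` whenever `|w - k| ≤ arctan m₀ / 2π`
  (`k ∈ ℤ`) and `r w ∈ ℤ + 1/2` whenever `w` is at distance `≥ arctan m₀ / 2π` from `ℤ`.  It
  rewrites the rigid angular coordinate `e^{-i arctan x₂}` of the fold tube as the standard angle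
  `x₂ / 2m₀` and collapses everything else to the antipode `-1`.

Elementary real analysis; no references needed beyond the definitions. [folklore]
-/

set_option linter.dupNamespace false

noncomputable section

open Set Function

namespace Summit.SmoothPoincare4.SmoothPoincare4.Cruxes.RungOne.Sketch

/-- **Equivariant extension**: a continuous function on `[-1/2, 1/2]` fixing the two endpoints
`∓1/2` extends to a continuous `r : ℝ → ℝ` with `r (w + 1) = r w + 1` (so `r - id` is the
`1`-periodic extension of `κ - id`). [folklore] -/
theorem helper_degree_equivariant_extension (κ : ℝ → ℝ)
    (hκ : ContinuousOn κ (Icc (-1 / 2) (1 / 2))) (h0 : κ (-1 / 2) = -1 / 2)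
    (h1 : κ (1 / 2) = 1 / 2) :
    ∃ r : ℝ → ℝ, Continuous r ∧ (∀ w, r (w + 1) = r w + 1) ∧
      ∀ w ∈ Icc (-1 / 2 : ℝ) (1 / 2), r w = κ w := by
  -- the periodic part `F (x) = κ (x - 1/2) - (x - 1/2)` on `[0, 1]`, read through `fract`
  set F : ℝ → ℝ := fun x => κ (x - 1 / 2) - (x - 1 / 2) with hF
  have hFc : ContinuousOn F (Icc 0 1) := by
    refine ContinuousOn.sub (hκ.comp (continuousOn_id.sub continuousOn_const) ?_)
      (continuousOn_id.sub continuousOn_const)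
    intro x hx
    exact ⟨by linarith [hx.1], by linarith [hx.2]⟩
  have hF01 : F 0 = F 1 := by
    simp only [hF]
    rw [show (0 : ℝ) - 1 / 2 = -1 / 2 by norm_num, show (1 : ℝ) - 1 / 2 = 1 / 2 by norm_num, h0, h1]
    norm_num
  have hFf : Continuous (F ∘ Int.fract) := ContinuousOn.comp_fract'' hFc hF01
  refine ⟨fun w => w + F (Int.fract (w + 1 / 2)), ?_, fun w => ?_, fun w hw => ?_⟩
  · exact continuous_id.add (hFf.comp (continuous_id.add continuous_const))
  · simp only
    rw [show w + 1 + 1 / 2 = (w + 1 / 2) + 1 by ring, Int.fract_add_one]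
    ring
  · simp only
    rcases hw.2.lt_or_eq with hlt | heq
    · have hfr : Int.fract (w + 1 / 2) = w + 1 / 2 := by
        rw [Int.fract_eq_self]; constructor <;> linarith [hw.1]
      rw [hfr, hF]
      ring_nf
    · rw [heq, show (1 / 2 : ℝ) + 1 / 2 = 1 by norm_num, Int.fract_one, hF]
      simp only
      rw [show (0 : ℝ) - 1 / 2 = -1 / 2 by norm_num, h0, h1]
      norm_num

/-- **The collapse map of the degree lemma.** For `m₀ > 0` put `w₁ = arctan m₀ / 2π ∈ (0, 1/4)`.
There is a continuous `r : ℝ → ℝ` with `r (w + k) = r w + k` (`k ∈ ℤ`), equal to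
`k + tan (2π (w - k)) / (2 m₀)` on `[k - w₁, k + w₁]` and taking values in `ℤ + 1/2` at every
point at distance `≥ w₁` from `ℤ`. [folklore] -/
theorem helper_degree_collapse : ∀ (m₀ : ℝ), 0 < m₀ → ∃ r : ℝ → ℝ, Continuous r ∧ (∀ (w : ℝ) (k : ℤ), r (w + k) = r w + k) ∧ (∀ (w : ℝ) (k : ℤ), |w - k| ≤ Real.arctan m₀ / (2 * Real.pi) → r w = k + Real.tan (2 * Real.pi * (w - k)) / (2 * m₀)) ∧ (∀ w : ℝ, (∀ k : ℤ, Real.arctan m₀ / (2 * Real.pi) ≤ |w - k|) → ∃ n : ℤ, r w = n + 1 / 2) := by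
  intro m₀ hm
  set w₁ : ℝ := Real.arctan m₀ / (2 * Real.pi) with hw₁
  have hπ : 0 < Real.pi := Real.pi_pos
  have h2π : 0 < 2 * Real.pi := by positivity
  have hat : 0 < Real.arctan m₀ := Real.arctan_pos.2 hm
  have hat2 : Real.arctan m₀ < Real.pi / 2 := Real.arctan_lt_pi_div_two m₀
  have hw₁pos : 0 < w₁ := div_pos hat h2π
  have hw₁lt : w₁ < 1 / 4 := by
    rw [hw₁, div_lt_iff₀ h2π]; linarith
  have h2πw₁ : 2 * Real.pi * w₁ = Real.arctan m₀ := by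
    rw [hw₁]; field_simp
  -- the clamps
  set cl : ℝ → ℝ := fun w => max (-w₁) (min w₁ w) with hcl
  have hcl_mem : ∀ w, cl w ∈ Icc (-w₁) w₁ := fun w =>
    ⟨le_max_left _ _, max_le (by linarith) (min_le_left _ _)⟩
  have hcl_id : ∀ w, |w| ≤ w₁ → cl w = w := fun w hw => by
    rw [abs_le] at hw
    rw [hcl]; simp only
    rw [min_eq_right hw.2, max_eq_right hw.1]
  have hcl_cont : Continuous cl := continuous_const.max (continuous_const.min continuous_id)
  set κ : ℝ → ℝ := fun w =>
    max (-1 / 2) (min (1 / 2) (Real.tan (2 * Real.pi * cl w) / (2 * m₀))) with hκ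
  -- `tan (2π ·)` is continuous on `[-w₁, w₁]`
  have hcos : ∀ x ∈ Icc (-w₁) w₁, Real.cos (2 * Real.pi * x) ≠ 0 := by
    intro x hx
    refine (Real.cos_pos_of_mem_Ioo ⟨?_, ?_⟩).ne'
    · have : -(Real.arctan m₀) ≤ 2 * Real.pi * x := by rw [← h2πw₁]; nlinarith [hx.1]
      linarith
    · have : 2 * Real.pi * x ≤ Real.arctan m₀ := by rw [← h2πw₁]; nlinarith [hx.2]
      linarith
  have hκc : Continuous κ := by
    refine continuous_const.max (continuous_const.min (Continuous.div_const ?_ _))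
    have htan : ContinuousOn (fun x => Real.tan (2 * Real.pi * x)) (Icc (-w₁) w₁) :=
      Real.continuousOn_tan.comp (continuous_const.mul continuous_id).continuousOn
        fun x hx => hcos x hx
    exact htan.comp_continuous hcl_cont hcl_mem
  have htanw₁ : Real.tan (2 * Real.pi * w₁) = m₀ := by rw [h2πw₁, Real.tan_arctan]
  have hκ_hi : ∀ w, w₁ ≤ w → κ w = 1 / 2 := fun w hw => by
    have : cl w = w₁ := by
      rw [hcl]; simp only; rw [min_eq_left hw, max_eq_right (by linarith)]
    rw [hκ]; simp only; rw [this, htanw₁]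
    rw [show m₀ / (2 * m₀) = 1 / 2 by field_simp]
    norm_num
  have hκ_lo : ∀ w, w ≤ -w₁ → κ w = -1 / 2 := fun w hw => by
    have : cl w = -w₁ := by
      rw [hcl]; simp only; rw [min_eq_right (by linarith), max_eq_left hw]
    rw [hκ]; simp only; rw [this, show 2 * Real.pi * -w₁ = -(2 * Real.pi * w₁) by ring,
      Real.tan_neg, htanw₁, show -m₀ / (2 * m₀) = -1 / 2 by field_simp]
    norm_num
  have hκ_mid : ∀ w, |w| ≤ w₁ → κ w = Real.tan (2 * Real.pi * w) / (2 * m₀) := fun w hw => by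
    rw [hκ]; simp only; rw [hcl_id w hw]
    have hb : |Real.tan (2 * Real.pi * w)| ≤ m₀ := by
      rw [abs_le] at hw ⊢
      constructor
      · rw [← neg_le_neg_iff, ← Real.tan_neg, ← htanw₁, neg_neg]
        rcases eq_or_lt_of_le hw.1 with h | h
        · rw [← h]; ring_nf; rfl
        · refine (Real.tan_lt_tan_of_lt_of_lt_pi_div_two ?_ ?_ (by nlinarith)).le
          · rw [show -(2 * Real.pi * w) = 2 * Real.pi * (-w) by ring, ← h2πw₁] at *
            nlinarith
          · rw [h2πw₁]; exact hat2
      · rw [← htanw₁]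
        rcases eq_or_lt_of_le hw.2 with h | h
        · rw [h]
        · refine (Real.tan_lt_tan_of_lt_of_lt_pi_div_two ?_ ?_ (by nlinarith)).le
          · have : -(Real.arctan m₀) ≤ 2 * Real.pi * w := by rw [← h2πw₁]; nlinarith [hw.1]
            linarith
          · rw [h2πw₁]; exact hat2
    rw [abs_le] at hb
    have hlo : -1 / 2 ≤ Real.tan (2 * Real.pi * w) / (2 * m₀) := by
      rw [le_div_iff₀ (by positivity)]; linarith
    have hhi : Real.tan (2 * Real.pi * w) / (2 * m₀) ≤ 1 / 2 := by
      rw [div_le_iff₀ (by positivity)]; linarith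
    rw [min_eq_right hhi, max_eq_right hlo]
  obtain ⟨r, hrc, hr1, hrκ⟩ := helper_degree_equivariant_extension κ hκc.continuousOn
    (hκ_lo _ (by linarith)) (hκ_hi _ (by linarith))
  have hrk : ∀ (w : ℝ) (k : ℤ), r (w + k) = r w + k :=
    Literature.Topology.PlaneTopology.CircleTwist.apply_add_intCast_of_add_one hr1
  refine ⟨r, hrc, hrk, fun w k hwk => ?_, fun w hw => ?_⟩
  · have e : w = (w - k) + k := by ring
    rw [e, hrk, hrκ _ ⟨by rw [abs_le] at hwk; linarith [hwk.1], by rw [abs_le] at hwk; linarith [hwk.2]⟩,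
      hκ_mid _ hwk]
    ring_nf
  · set n : ℤ := ⌊w + 1 / 2⌋ with hn
    have hw' : w - n ∈ Ico (-1 / 2 : ℝ) (1 / 2) := by
      have h1 := Int.floor_le (w + 1 / 2)
      have h2 := Int.lt_floor_add_one (w + 1 / 2)
      constructor <;> [linarith; linarith]
    have e : w = (w - n) + n := by ring
    have hfar := hw n
    rcases le_abs'.1 hfar with hneg | hpos
    · refine ⟨n - 1, ?_⟩
      rw [e, hrk, hrκ _ ⟨hw'.1, hw'.2.le⟩, hκ_lo _ hneg]
      push_cast; ring
    · refine ⟨n, ?_⟩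
      rw [e, hrk, hrκ _ ⟨hw'.1, hw'.2.le⟩, hκ_hi _ hpos]
      ring

end Summit.SmoothPoincare4.SmoothPoincare4.Cruxes.RungOne.Sketch

end
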